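import Mathlib

/-!
# Finite check (gen 3, ideator 1) behind card `lambda-kolyvagin-rigidity-two`, §(H.3)/(H.4) at p = 2

For an elliptic curve with 2-adic image `GL₂(ℤ₂)` the Mazur–Rubin hypothesis (H.3)
`H¹(ℚ(E[2^∞])/ℚ, E[2]) = 0` fails.  The hand computation recorded in the ideator's NOTES (A4′)
says: the group is `𝔽₂ · d₀`, ONE class, inflated from `Gal(ℚ(E[4])/ℚ) = GL₂(ℤ/4)`, and `d₀` is
TRANSVERSE-VISIBLE at every Kolyvagin prime of level ≥ 2: `loc_ℓ(c₀) ≠ 0` in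
`H¹_f(ℚ_ℓ, E[2]) = E[2]/(Frob_ℓ − 1)E[2]` whenever `ℓ ≡ 1 (mod 4)` and `T₂E/(4, Frob_ℓ − 1) ≅ ℤ/4`.
Hence restriction to `G_Ω` is injective on every modified Selmer group `H¹_{F(n)}(ℚ, E[2])` with
`n` divisible by a level-≥2 prime, and the p = 2 failure of MR's useful-prime lemma ((H.4):
`Hom(T̄, T̄*) ≠ 0` and `p ≤ 4`) is confined to level 1.

This file checks the three FINITE statements by `native_decide` (axiom `Lean.ofReduceBool`;
evidence file, not a Theorems proposal):
* `d0_cocycle`   — the explicit map `d₀ : GL₂(ℤ/4) → 𝔽₂²` is a 1-cocycle for the natural action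
                   through `GL₂(𝔽₂)`;
* `d0_not_coboundary` — it is not a coboundary (so `H¹(GL₂(ℤ/4), 𝔽₂²) ≠ 0`; the Python companion
                   `h1_gl2z4.py` computes `dim Z¹ = 3`, `dim B¹ = 2`, i.e. `H¹ = 𝔽₂` exactly);
* `d0_visible_at_level_two` — for every `g ∈ GL₂(ℤ/4)` with `det g = 1`, `g ≢ 1 (mod 2)` and
                   `det (g − 1) = 0` (i.e. `coker (g − 1) ≅ ℤ/4`: a level-2 Kolyvagin Frobenius),
                   `d₀ g ∉ (ḡ − 1)𝔽₂²`.
`d₀` is built from the splitting `GL₂(ℤ/4) = (1 + 2M₂(𝔽₂)) ⋊ S₃` (`s` = the permutation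
representation of `S₃` on the sum-zero lattice, reduced mod 4) and the unique `S₃`-equivariant
projection `m : M₂(𝔽₂) → 𝔽₂²`, `(a b; c d) ↦ (a+b+d, a+c+d)` (kernel `𝔽₂[ω] = {0, 1, ω, ω²}`).
-/

namespace Summit.BirchSwinnertonDyer.BirchSwinnertonDyer.Cruxes.OrdMissingLowerBoundAtTwo.LambdaKolyvaginRigidityTwo.CheckH1GL2Z4

abbrev M4 := Matrix (Fin 2) (Fin 2) (ZMod 4)
abbrev M2 := Matrix (Fin 2) (Fin 2) (ZMod 2)
abbrev V := Fin 2 → ZMod 2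

/-- reduction mod 2 of a mod-4 matrix -/
def red (g : M4) : M2 := g.map (ZMod.castHom (show 2 ∣ 4 by decide) (ZMod 2))

/-- the permutation-representation section `S₃ = GL₂(𝔽₂) → GL₂(ℤ) → GL₂(ℤ/4)` -/
def s (gb : M2) : M4 :=
  if gb = !![1, 0; 0, 1] then !![1, 0; 0, 1] else
  if gb = !![1, 0; 1, 1] then !![1, 0; 1, 3] else
  if gb = !![1, 1; 0, 1] then !![3, 1; 0, 1] else
  if gb = !![0, 1; 1, 1] then !![0, 3; 1, 3] else
  if gb = !![1, 1; 1, 0] then !![3, 1; 3, 0] else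
  !![0, 3; 3, 0]

/-- inverse of `s gb` (the involutions are self-inverse, the two 3-cycles are mutually inverse) -/
def sInv (gb : M2) : M4 :=
  if gb = !![0, 1; 1, 1] then !![3, 1; 3, 0] else
  if gb = !![1, 1; 1, 0] then !![0, 3; 1, 3] else s gb

/-- `x ↦ x/2 (mod 2)` on the even residues `{0, 2}` of `ℤ/4` -/
def half (x : ZMod 4) : ZMod 2 := if x = 2 then 1 else 0

/-- `Ā(g) ∈ M₂(𝔽₂)` with `g = (1 + 2A) · s(ḡ)` -/
def abar (g : M4) : M2 := (g * sInv (red g) - 1).map half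

/-- the cocycle `d₀(g) = m(Ā(g))`, `m (a b; c d) = (a+b+d, a+c+d)` -/
def d0 (g : M4) : V :=
  ![abar g 0 0 + abar g 0 1 + abar g 1 1, abar g 0 0 + abar g 1 0 + abar g 1 1]

/-- odd determinant = membership in `GL₂(ℤ/4)` -/
def InGL (g : M4) : Prop := g.det = 1 ∨ g.det = 3

instance : DecidablePred InGL := fun g => by unfold InGL; infer_instance

theorem s_section : ∀ gb : M2, gb.det = 1 → red (s gb) = gb ∧ s gb * sInv gb = 1 := by
  native_decide

theorem d0_cocycle :
    ∀ g h : M4, InGL g → InGL h → d0 (g * h) = d0 g + (red g).mulVec (d0 h) := by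
  native_decide

theorem d0_not_coboundary :
    ¬ ∃ v : V, ∀ g : M4, InGL g → d0 g = (red g).mulVec v - v := by
  native_decide

/-- level-2 Kolyvagin Frobenii: `det g = 1` (ℓ ≡ 1 mod 4), `g ≢ 1 mod 2`, `det (g - 1) = 0`
(so `coker (g - 1) ≅ ℤ/4`); at each of them `d₀ g ∉ (ḡ − 1)·𝔽₂²`, i.e. `loc_ℓ c₀ ≠ 0`. -/
theorem d0_visible_at_level_two :
    ∀ g : M4, g.det = 1 → red g ≠ 1 → (g - 1).det = 0 →
      ∀ v : V, d0 g ≠ (red g).mulVec v - v := by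
  native_decide

/-- sanity: there are exactly 12 such classes in `GL₂(ℤ/4)` (companion script: 12). -/
theorem card_level_two :
    (Finset.univ.filter (fun g : M4 => g.det = 1 ∧ red g ≠ 1 ∧ (g - 1).det = 0)).card = 12 := by
  native_decide

/-- contrast, level 1: among `g` with `ḡ` a transposition both values of `loc` occur —
here one explicit `g` with `d₀ g ∈ (ḡ − 1)𝔽₂²` (namely `g = s(τ̄)` itself, `d₀ g = 0`). -/
theorem level_one_can_vanish :
    ∃ g : M4, InGL g ∧ red g = !![1, 1; 0, 1] ∧ ∃ v : V, d0 g = (red g).mulVec v - v := by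
  native_decide

end Summit.BirchSwinnertonDyer.BirchSwinnertonDyer.Cruxes.OrdMissingLowerBoundAtTwo.LambdaKolyvaginRigidityTwo.CheckH1GL2Z4
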